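import Summits.KontsevichZagierPeriods.KontsevichZagierPeriods.Theses.IsogenyCertificates

/-!
# `EffectiveXMapChains` (stmt-KontsevichZagierPeriods-10664) — negative knowledge, part 1: the reduction to counted transfer

Support file for the crux `IsogenyCertificates.EffectiveXMapChains` (cdisprove seat, gen 1; work file
`Cruxes/EffectiveXMapChains/Disproof.lean`, where the anatomy `crux ↔ (DegreeHypothesis →
EffectiveConclusion)` is recorded by `Iff.rfl`). The crux says: a Masser–Wüstholz/Gaudron–Rémond-type
bound on the degree of an x-rational isogeny datum `(f, g, c)` (`c²·g·(f³ + A'fg² + B'g³) = P·W²`,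
`W = f'g − fg' ≠ 0`) implies a poly-log bound on the LENGTH of the chain of Kontsevich–Zagier moves
joining two equal-valued real-period representations `[{P>0}, a/√P]`, `[{P'>0}, b/√P']`.

Main result: `effectiveXMapChains_of_countedTransfer` — the crux follows from crux #3
(`XMapPeriodTransfer`) established WITH a move count `L N ≤ C₁·max(1,N)^d` depending only on the
degree `N = max (deg f) (deg g)` of the datum USED; the constants are `C = max(C₁,0)·max(c₀,1)^d`,
`k = max(κ,0)·d` (real-exponent bookkeeping; `max|A||B| > 0` by nonsingularity, so no `log 0`).
So the isogeny-estimate layer of the crux is bookkeeping and its content is crux #3 with counting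
(the plan's count is `O(N)` per datum, see part 3 `Mechanism`). Also:
`effectiveXMapChains_of_conclusion` (the antecedent is not load-bearing for truth),
`xMapPeriodTransfer_of_effective` (the crux plus its antecedent implies crux #3: a signed chain of
moves sums to a relation, `sum_mem_relations_of_chain`), `exists_chain_of_mem_relations`.
No `Prop`-valued definitions are introduced (hypotheses are spelled out), by the tree's rule that
`Summits/` carries only registered obligations.

References: Kontsevich–Zagier, *Periods* (2001), §1.2 (the rules); Gaudron–Rémond (2014), Thm 1.4
and Masser–Wüstholz (1990) (minimal isogeny degree, the shape of the antecedent).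
-/

noncomputable section

namespace Summit.KontsevichZagierPeriods.IsogenyCertificates.EffectiveXMapChainsNegative

open Polynomial Set MeasureTheory
open Literature.NumberTheory.Transcendental
open Summit.KontsevichZagierPeriods.KontsevichZagierPeriods.Theses.IsogenyCertificates

/-! ## Signed chains of moves -/

/-- The four generating move sets of the KZ calculus (rules 1a, 1b, 2, 3), as one set; the crux's
chains are lists of elements `x` with `x ∈ moves ∨ -x ∈ moves`. [cite: KontsevichZagier2001, §1.2] -/
def moves : Set KZ.FormalRep :=
  KZ.domainAddRel ∪ KZ.integrandAddRel ∪ KZ.changeOfVariablesRel ∪ KZ.newtonLeibnizRel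

/-- Any signed chain of moves sums to a relation of the calculus (`KZ.relations` is the subgroup
generated by `moves`). [cite: KontsevichZagier2001, §1.2] -/
theorem sum_mem_relations_of_chain {l : List KZ.FormalRep}
    (hl : ∀ x ∈ l, x ∈ moves ∨ -x ∈ moves) : l.sum ∈ KZ.relations := by
  induction l with
  | nil => simp
  | cons x t ih =>
    rw [List.sum_cons]
    refine add_mem ?_ (ih fun y hy => hl y (List.mem_cons_of_mem _ hy))
    rcases hl x List.mem_cons_self with hx | hx
    · exact AddSubgroup.subset_closure hx
    · have h' : -x ∈ KZ.relations := AddSubgroup.subset_closure hx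
      simpa using KZ.relations.neg_mem h'

/-- Conversely every relation is the sum of SOME signed chain of moves (no length information):
closure induction. [cite: KontsevichZagier2001, §1.2] -/
theorem exists_chain_of_mem_relations {d : KZ.FormalRep} (hd : d ∈ KZ.relations) :
    ∃ l : List KZ.FormalRep, (∀ x ∈ l, x ∈ moves ∨ -x ∈ moves) ∧ l.sum = d := by
  refine AddSubgroup.closure_induction
    (p := fun d _ => ∃ l : List KZ.FormalRep, (∀ x ∈ l, x ∈ moves ∨ -x ∈ moves) ∧ l.sum = d)
    ?_ ?_ ?_ ?_ hd
  · intro x hx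
    exact ⟨[x], fun y hy => by simp only [List.mem_singleton] at hy; exact Or.inl (hy ▸ hx),
      by simp⟩
  · exact ⟨[], fun y hy => by simp at hy, by simp⟩
  · rintro x y - - ⟨l₁, h₁, hs₁⟩ ⟨l₂, h₂, hs₂⟩
    refine ⟨l₁ ++ l₂, fun z hz => ?_, by simp [hs₁, hs₂]⟩
    rcases List.mem_append.mp hz with hz | hz
    · exact h₁ z hz
    · exact h₂ z hz
  · rintro x - ⟨l, h, hs⟩
    refine ⟨(l.map fun z => -z).reverse, fun z hz => ?_, ?_⟩
    · simp only [List.mem_reverse, List.mem_map] at hz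
      obtain ⟨w, hw, rfl⟩ := hz
      rcases h w hw with hw' | hw'
      · exact Or.inr (by simpa using hw')
      · exact Or.inl hw'
    · rw [← List.sum_neg_reverse, hs]

/-- **The antecedent is not load-bearing for truth**: the crux follows from its consequent alone
(over `ℤ`-models the antecedent holds with `κ = 0` by Mazur–Kenku; it is used by the PROOF). [folklore] -/
theorem effectiveXMapChains_of_conclusion
    (h : ∃ C₀ k : ℝ, ∀ (A B A' B' : ℤ), 4 * A ^ 3 + 27 * B ^ 2 ≠ 0 → 4 * A' ^ 3 + 27 * B' ^ 2 ≠ 0 →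
      (∃ (f g : ℚ[X]) (c : ℚ), derivative f * g - f * derivative g ≠ 0 ∧
        C (c ^ 2) * g * (f ^ 3 + C (A' : ℚ) * f * g ^ 2 + C (B' : ℚ) * g ^ 3) =
          (X ^ 3 + C (A : ℚ) * X + C (B : ℚ)) * (derivative f * g - f * derivative g) ^ 2) →
      ∀ (a b : ℚ), 0 < a → 0 < b → ∀ (r r' : KZ.IntegralRep 1),
        r.domain = {x | 0 < x 0 ^ 3 + (A : ℝ) * x 0 + (B : ℝ)} →
        EqOn r.integrand (fun x => (a : ℝ) / Real.sqrt (x 0 ^ 3 + (A : ℝ) * x 0 + (B : ℝ)))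
          r.domain →
        r'.domain = {x | 0 < x 0 ^ 3 + (A' : ℝ) * x 0 + (B' : ℝ)} →
        EqOn r'.integrand (fun x => (b : ℝ) / Real.sqrt (x 0 ^ 3 + (A' : ℝ) * x 0 + (B' : ℝ)))
          r'.domain →
        r.value = r'.value →
        ∃ l : List KZ.FormalRep, (l.length : ℝ) ≤
            C₀ * (max 1 (Real.log (max (max |(A : ℝ)| |(B : ℝ)|) (max |(A' : ℝ)| |(B' : ℝ)|)))) ^ k ∧
          (∀ x ∈ l, x ∈ (KZ.domainAddRel ∪ KZ.integrandAddRel ∪ KZ.changeOfVariablesRel ∪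
              KZ.newtonLeibnizRel) ∨ -x ∈ (KZ.domainAddRel ∪ KZ.integrandAddRel ∪
              KZ.changeOfVariablesRel ∪ KZ.newtonLeibnizRel)) ∧ l.sum = KZ.of r - KZ.of r') :
    EffectiveXMapChains :=
  fun _ => h

/-! ## The complexity parameter -/

/-- `max(1, log H)` with `H = max(|A|,|B|,|A'|,|B'|)`, the crux's complexity parameter. [folklore] -/
def heightLog (A B A' B' : ℤ) : ℝ :=
  max 1 (Real.log (max (max |(A : ℝ)| |(B : ℝ)|) (max |(A' : ℝ)| |(B' : ℝ)|)))

/-- Nonsingular coefficients are not both zero, so `max |A| |B| > 0` (no `log 0` junk in the crux).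
[folklore] -/
lemma max_abs_pos_of_disc_ne_zero {A B : ℤ} (h : 4 * A ^ 3 + 27 * B ^ 2 ≠ 0) :
    0 < max |(A : ℝ)| |(B : ℝ)| := by
  rcases eq_or_ne A 0 with rfl | hA
  · rcases eq_or_ne B 0 with rfl | hB
    · simp at h
    · exact lt_max_of_lt_right (by exact_mod_cast abs_pos.mpr hB)
  · exact lt_max_of_lt_left (by exact_mod_cast abs_pos.mpr hA)

/-- `max(1, log max(|A|,|B|)) ≤ heightLog A B A' B'`. [folklore] -/
lemma heightLog_ge {A B : ℤ} (A' B' : ℤ) (h : 4 * A ^ 3 + 27 * B ^ 2 ≠ 0) :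
    max 1 (Real.log (max |(A : ℝ)| |(B : ℝ)|)) ≤ heightLog A B A' B' :=
  max_le_max le_rfl (Real.log_le_log (max_abs_pos_of_disc_ne_zero h) (le_max_left _ _))

/-- `1 ≤ heightLog A B A' B'`. [folklore] -/
lemma one_le_heightLog (A B A' B' : ℤ) : 1 ≤ heightLog A B A' B' := le_max_left _ _

/-! ## The reduction -/

/-- **Reduction (the proof skeleton, checked).** If crux #3 `XMapPeriodTransfer` holds WITH a bound
`L N` on the number of signed moves depending only on the degree `N = max (deg f) (deg g)` of the
datum used ("counted transfer"), and `L N ≤ C₁·max(1,N)^d` (`d ≥ 0`), then `EffectiveXMapChains`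
holds: from the antecedent's datum of degree `N ≤ c₀·M^κ` (`M = max(1, log max(|A|,|B|)) ≤
heightLog`) the length is `≤ max(C₁,0)·max(c₀,1)^d · heightLog^{max(κ,0)·d}`. The Masser–Wüstholz
layer of the crux is exactly this bookkeeping. [folklore] -/
theorem effectiveXMapChains_of_countedTransfer {L : ℕ → ℝ} {C₁ d : ℝ} (hd : 0 ≤ d)
    (hL : ∀ N : ℕ, L N ≤ C₁ * (max 1 (N : ℝ)) ^ d)
    (H : ∀ (A B A' B' : ℤ), 4 * A ^ 3 + 27 * B ^ 2 ≠ 0 → 4 * A' ^ 3 + 27 * B' ^ 2 ≠ 0 →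
      ∀ (f g : ℚ[X]) (c : ℚ), derivative f * g - f * derivative g ≠ 0 →
        C (c ^ 2) * g * (f ^ 3 + C (A' : ℚ) * f * g ^ 2 + C (B' : ℚ) * g ^ 3) =
          (X ^ 3 + C (A : ℚ) * X + C (B : ℚ)) * (derivative f * g - f * derivative g) ^ 2 →
      ∀ (a b : ℚ), 0 < a → 0 < b → ∀ (r r' : KZ.IntegralRep 1),
        r.domain = {x | 0 < x 0 ^ 3 + (A : ℝ) * x 0 + (B : ℝ)} →
        EqOn r.integrand (fun x => (a : ℝ) / Real.sqrt (x 0 ^ 3 + (A : ℝ) * x 0 + (B : ℝ)))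
          r.domain →
        r'.domain = {x | 0 < x 0 ^ 3 + (A' : ℝ) * x 0 + (B' : ℝ)} →
        EqOn r'.integrand (fun x => (b : ℝ) / Real.sqrt (x 0 ^ 3 + (A' : ℝ) * x 0 + (B' : ℝ)))
          r'.domain →
        r.value = r'.value →
        ∃ l : List KZ.FormalRep, (l.length : ℝ) ≤ L (max f.natDegree g.natDegree) ∧
          (∀ x ∈ l, x ∈ moves ∨ -x ∈ moves) ∧ l.sum = KZ.of r - KZ.of r') :
    EffectiveXMapChains := by
  rintro ⟨κ, c₀, hyp⟩
  refine ⟨max C₁ 0 * (max c₀ 1) ^ d, max κ 0 * d, ?_⟩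
  intro A B A' B' hΔ hΔ' hdat a b ha hb r r' h1 h2 h3 h4 h5
  obtain ⟨f, g, c, hW, hI, hdeg⟩ := hyp A B A' B' hΔ hΔ' hdat
  obtain ⟨l, hl, hmem, hsum⟩ := H A B A' B' hΔ hΔ' f g c hW hI a b ha hb r r' h1 h2 h3 h4 h5
  refine ⟨l, hl.trans ?_, hmem, hsum⟩
  set N : ℕ := max f.natDegree g.natDegree with hN
  set M : ℝ := max 1 (Real.log (max |(A : ℝ)| |(B : ℝ)|)) with hM
  have hM1 : 1 ≤ M := le_max_left _ _
  have hM0 : 0 ≤ M := zero_le_one.trans hM1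
  have hMH : M ≤ heightLog A B A' B' := heightLog_ge A' B' hΔ
  set κ' : ℝ := max κ 0 with hκ'
  set c' : ℝ := max c₀ 1 with hc'
  have hκ'0 : 0 ≤ κ' := le_max_right _ _
  have hc'1 : 1 ≤ c' := le_max_right _ _
  have hc'0 : 0 ≤ c' := zero_le_one.trans hc'1
  have hMκ : M ^ κ ≤ M ^ κ' := Real.rpow_le_rpow_of_exponent_le hM1 (le_max_left _ _)
  have hMκpos : 0 < M ^ κ := Real.rpow_pos_of_pos (zero_lt_one.trans_le hM1) κ
  have hN1 : (N : ℝ) ≤ c' * M ^ κ' := by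
    calc (N : ℝ) ≤ c₀ * M ^ κ := hdeg
      _ ≤ c' * M ^ κ := mul_le_mul_of_nonneg_right (le_max_left _ _) hMκpos.le
      _ ≤ c' * M ^ κ' := mul_le_mul_of_nonneg_left hMκ hc'0
  have hone : (1 : ℝ) ≤ c' * M ^ κ' :=
    one_le_mul_of_one_le_of_one_le hc'1 (Real.one_le_rpow hM1 hκ'0)
  have hmax : max 1 (N : ℝ) ≤ c' * M ^ κ' := max_le hone hN1
  have hmax0 : 0 ≤ max 1 (N : ℝ) := zero_le_one.trans (le_max_left _ _)
  calc L N ≤ C₁ * (max 1 (N : ℝ)) ^ d := hL N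
    _ ≤ max C₁ 0 * (max 1 (N : ℝ)) ^ d :=
        mul_le_mul_of_nonneg_right (le_max_left _ _) (Real.rpow_nonneg hmax0 d)
    _ ≤ max C₁ 0 * (c' * M ^ κ') ^ d :=
        mul_le_mul_of_nonneg_left (Real.rpow_le_rpow hmax0 hmax hd) (le_max_right _ _)
    _ = max C₁ 0 * (c' ^ d * M ^ (κ' * d)) := by
        rw [Real.mul_rpow hc'0 (Real.rpow_nonneg hM0 _), Real.rpow_mul hM0]
    _ ≤ max C₁ 0 * (c' ^ d * heightLog A B A' B' ^ (κ' * d)) := by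
        refine mul_le_mul_of_nonneg_left ?_ (le_max_right _ _)
        exact mul_le_mul_of_nonneg_left
          (Real.rpow_le_rpow hM0 hMH (mul_nonneg hκ'0 hd)) (Real.rpow_nonneg hc'0 d)
    _ = max C₁ 0 * c' ^ d * heightLog A B A' B' ^ (κ' * d) := by ring

/-- **Granted its antecedent, the crux implies crux #3 `XMapPeriodTransfer`** (a signed chain of
moves is in particular an equivalence of the two representations). [folklore] -/
theorem xMapPeriodTransfer_of_effective
    (hD : ∃ κ c₀ : ℝ, ∀ (A B A' B' : ℤ), 4 * A ^ 3 + 27 * B ^ 2 ≠ 0 → 4 * A' ^ 3 + 27 * B' ^ 2 ≠ 0 →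
      (∃ (f g : ℚ[X]) (c : ℚ), derivative f * g - f * derivative g ≠ 0 ∧
        C (c ^ 2) * g * (f ^ 3 + C (A' : ℚ) * f * g ^ 2 + C (B' : ℚ) * g ^ 3) =
          (X ^ 3 + C (A : ℚ) * X + C (B : ℚ)) * (derivative f * g - f * derivative g) ^ 2) →
      ∃ (f g : ℚ[X]) (c : ℚ), derivative f * g - f * derivative g ≠ 0 ∧
        (C (c ^ 2) * g * (f ^ 3 + C (A' : ℚ) * f * g ^ 2 + C (B' : ℚ) * g ^ 3) =
            (X ^ 3 + C (A : ℚ) * X + C (B : ℚ)) * (derivative f * g - f * derivative g) ^ 2 ∧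
          ((max f.natDegree g.natDegree : ℕ) : ℝ) ≤
            c₀ * (max 1 (Real.log (max |(A : ℝ)| |(B : ℝ)|))) ^ κ))
    (h : EffectiveXMapChains) : XMapPeriodTransfer := by
  obtain ⟨C, k, hC⟩ := h hD
  intro A B A' B' hΔ hΔ' f g c hW hI a b ha hb r r' h1 h2 h3 h4 h5
  obtain ⟨l, -, hmem, hsum⟩ := hC A B A' B' hΔ hΔ' ⟨f, g, c, hW, hI⟩ a b ha hb r r' h1 h2 h3 h4 h5
  show KZ.of r - KZ.of r' ∈ KZ.relations
  rw [← hsum]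
  exact sum_mem_relations_of_chain hmem

end Summit.KontsevichZagierPeriods.IsogenyCertificates.EffectiveXMapChainsNegative
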